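import Mathlib
import HarnessLib
import Summits.NavierStokesRegularity.NavierStokesRegularity.Theorems.UnthreadedDoorNetFluxDefs
import Summits.NavierStokesRegularity.NavierStokesRegularity.Theorems.UnthreadedDoorVorticityOfClass
import Summits.NavierStokesRegularity.NavierStokesRegularity.Theorems.UnthreadedDoorCellFluxDefs
import Summits.NavierStokesRegularity.NavierStokesRegularity.Theorems.UnthreadedDoorCellFluxZDefs
import Summits.NavierStokesRegularity.NavierStokesRegularity.Theorems.UnthreadedDoorCellFluxForwardVanishing
import Summits.NavierStokesRegularity.NavierStokesRegularity.Theorems.UnthreadedDoorCellFluxKNSSTransfer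
import Summits.NavierStokesRegularity.NavierStokesRegularity.Theorems.UnthreadedDoorCellFluxZonalKinematic
import Summits.NavierStokesRegularity.NavierStokesRegularity.Theorems.UnthreadedDoorCellFluxAxisFrozen
import Literature.Analysis.FluidPDE.KNSSAxisymmetricNoSwirlHolds
import Literature.Analysis.FluidPDE.MildSolutionIsometryCovariance

/-!
# Route `UnthreadedDoor`, crux `PoloidalLiouville` (stmt-NavierStokesRegularity-1222), WALL W1 — SKELETON of Z `ZonalUnthreadedVorticityVanishes`
# («KNSS Thm 5.2 in a moving frame»; crux idea «cell-flux» v1.2.2, ns-idea-14 g6; critic ns-wall-crit-1 V22 addendum #2: «M-Lean, self-contained, Z first»)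

A typed FOUR-STUB decomposition of Z with a KERNEL-CHECKED composition `zonalVorticityVanishes_of_stubs` (pure logic, no sorry), so that
the zonal branch of cell-flux can be attacked by four provers in parallel.  Paper proofs: `Cruxes/PoloidalLiouville/CellFluxGaugeRigidityNote.md`
v1.1 (7f92ff69cb00) §3.  v1.1 (2026-08-29T03:5xZ): the cell-flux Defs twin LANDED as `Theorems/UnthreadedDoorCellFluxDefs.lean` (p692073, ns-qj-p1 g5),
so the composition now concludes the THEOREMS-SIDE decl `Theorems.PoloidalLiouville.CellFlux.ZonalUnthreadedVorticityVanishes` BY NAME (imported;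
an `rfl` guard below pins the local verbatim copy to it).  v1.2 (2026-08-29T05:4xZ, custodian ns-idea-14 g8): the Z Defs twin LANDED as
`Theorems/UnthreadedDoorCellFluxZDefs.lean` (p696007, ns-qj-p1 g6: frame vocabulary + the four stub statements + the composition, Theorems side) and
THREE of the four stubs are kernel theorems BY NAME — Z-2 `CellFlux.forwardVanishing` (p696036), Z-3 `CellFlux.knssTransfer` (p696933), Z-1a
`CellFlux.zonalKinematic` (p696980); they are wired below (`stub_… := <landed decl>`), §4 pins every local statement to its ZDefs twin by `rfl`, and the
ONLY remaining `sorry` of v1.2 was Z-1b `stub_axisFrozen`.  v1.3 (2026-08-29, custodian ns-idea-14 g8): Z-1b LANDED as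
`Theorems/UnthreadedDoorCellFluxAxisFrozen.lean` (p700380, ns-qj-p1 g6: `CellFlux.axisFrozen : CellFlux.AxisFrozen`; helpers `…AxisFrozenStatics`
p697816, `…AxisFrozenFrame` p698714, `…AxisFrozenPackage` p698963) — ALL FOUR STUBS ARE KERNEL THEOREMS BY NAME, this file has 0 `sorry`, and §5
states Z and the zonal Type-I rung Σ-Z UNCONDITIONALLY (`theorems_zonalVorticityVanishes`, `theorems_zonalTypeIScalarLiouville`).

* Z-1a `stub_zonalKinematic` (M−, KINEMATIC, one time slice): zonal (`ω ⊥ e`) + unthreaded (`ω ⊥ x − x₀`) + `div ω = 0` ⇒ `ω = f e_φ` about the axis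
  `x₀ + ℝe`; COCYCLE AVERAGING: `k(α) := R_α v(R_α⁻¹(· − x₀) + x₀) − v` is bounded, div- and curl-free, hence a constant, and the continuous cocycle
  `k(α+β) = k(α) + R_α k(β)` of the compact rotation group is the coboundary `k(α) = K̄ − R_α K̄` (`K̄` = Haar average), so `v + K̄` is EXACTLY
  axisymmetric; `ρ(v+K̄)_φ` is constant (`ω_ρ = ω_ζ = 0`) and tends to `0` at the axis, so NO SWIRL.  Output: a frame `R` (linear isometry taking the
  axis direction to `e_z`) and a constant `c` with `conjAxis R x₀ (v t − c)` axisymmetric without swirl.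
* Z-1b `stub_axisFrozen` (M, DYNAMIC): on a time interval where `ω ≢ 0`, the classical vorticity equation (IN TREE BY NAME:
  `Theorems.PoloidalLiouville.vorticityOfClass` ⇒ `IsVorticitySolutionOn (Iio 0) 1 v`) and the frame identity
  `∂_t e_φ + (c·∇)e_φ = P^{⊥φ}[ė × y + e × c]/‖e × y‖` force `ė = 0` and `c ∥ e` on `{f ≠ 0}`: ONE frame `R` works for all `t ≤ t₁` and the
  constant is absorbed (`β e` is axisymmetric without swirl).  Locally `e(t) ∥ ω(t,x₁) × ω(t,x₂)` (smooth in `t`).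
* Z-2 `stub_forwardVanishing` (S/M−): `ω(a) ≡ 0 ⇒ ω ≡ 0` on `[a, 0)`: `v(a)` is a constant (bounded harmonic), the Oseen-gauge representative
  (`Theorems.oseen_gauge_of_aestronglyMeasurable`) with constant datum stays constant (`oseenMild_bounded_unique`).
* Z-3 `stub_knssTransfer` (M−): a fixed frame on `(-∞, t₁]` ⇒ `ω ≡ 0` there: time-shift by `t₁` (`IsAncientMildSolution.time_translate`), translate by
  `x₀` (translation covariance of the duality class — S if not yet in the tree), conjugate by `R` (`IsBoundedAncientMildSolution.conj_linearIsometryEquiv`),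
  apply the PROVED `Literature.Analysis.FluidPDE.knss_axisymmetric_no_swirl_holds` (KNSS arXiv:0709.3599 Thm 5.2): every slice is a.e. `β e_z`, hence
  (continuity) constant, so `curl = 0` for `t < t₁`, and at `t₁` by continuity of `curl v` in `t`.
* COMPOSITION (kernel-checked): if `ω(t₁) ≢ 0` then by Z-2 `ω(t) ≢ 0` for all `t ≤ t₁`; Z-1a + Z-1b give one frame on `(-∞, t₁]`; Z-3 gives
  `ω(t₁) ≡ 0` — contradiction.

BOOKING (critic V22-P6 (a)): Z is information-grade for W1 (movement 0); it turns `ZonalTypeIScalarLiouville` into a theorem rung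
(`CellFlux.zonal_of_vanishes`) and, with Σ-5a, gives `UnthreadedAnalyticOrIrrotational` (conditional until both land).  NS regularity is NOT proved;
1222 `PoloidalLiouville` is OPEN; Z (the ZONAL branch only) is now a theorem; nothing in this file is sorried (v1.3).
-/

noncomputable section

set_option linter.dupNamespace false
set_option linter.unusedVariables false

open Set Function Filter Topology MeasureTheory
open scoped RealInnerProductSpace

namespace Summit.NavierStokesRegularity.NavierStokesRegularity.Cruxes.PoloidalLiouville.CellFlux.ZSkeleton

open Summit.NavierStokesRegularity.NavierStokesRegularity.Theorems.PoloidalLiouville.NetFlux (E3)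
open Literature.Analysis Literature.Analysis.FluidPDE

/-! ### §0 The target (verbatim copy of `CellFlux.ZonalUnthreadedVorticityVanishes`) and the frame vocabulary -/

/-- Z (verbatim copy of the sketch / Defs-twin decl `CellFlux.ZonalUnthreadedVorticityVanishes`). OPEN. -/
def ZonalUnthreadedVorticityVanishes : Prop :=
  ∀ (v : ℝ → E3 → E3) (x₀ : E3) (T : ℝ → E3 → ℝ),
    IsBoundedAncientMildSolution 1 v → (∀ t < 0, AEStronglyMeasurable (v t) volume) →
    ContDiffOn ℝ (⊤ : ℕ∞) (uncurry v) (Iio 0 ×ˢ univ) →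
    (∀ t < 0, ∀ x, curl (v t) x = cross (gradient (T t) x) (x - x₀)) →
    (∀ t < 0, ∃ e : E3, e ≠ 0 ∧ ∀ x, inner ℝ e (curl (v t) x) = 0) →
    ∀ t < 0, ∀ x, curl (v t) x = 0

/-- The slice `u` seen from the frame in which the axis through `p` with direction `R.symm e_z` becomes the `x₂`-axis through `0`:
`(conjAxis R p u) y = R (u (R⁻¹ y + p))`. -/
def conjAxis (R : E3 ≃ₗᵢ[ℝ] E3) (p : E3) (u : E3 → E3) : E3 → E3 :=
  fun y => R (u (R.symm y + p))

/-- «`u` is axisymmetric WITHOUT SWIRL about the axis through `p` that the frame `R` straightens to the `x₂`-axis» — the tree's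
`IsAxisymmetric` / `HasNoSwirl` (KNSS vocabulary, `Literature.Analysis.FluidPDE.AxisymmetricEuler`) after conjugation. -/
def IsAxisymmetricNoSwirlAbout (R : E3 ≃ₗᵢ[ℝ] E3) (p : E3) (u : E3 → E3) : Prop :=
  IsAxisymmetric (conjAxis R p u) ∧ HasNoSwirl (conjAxis R p u)

/-! ### §1 The four stub statements -/

/-- Z-1a (kinematic, one slice at a time; M−). -/
def ZonalKinematic : Prop :=
  ∀ (v : ℝ → E3 → E3) (x₀ : E3) (T : ℝ → E3 → ℝ),
    IsBoundedAncientMildSolution 1 v → (∀ t < 0, AEStronglyMeasurable (v t) volume) →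
    ContDiffOn ℝ (⊤ : ℕ∞) (uncurry v) (Iio 0 ×ˢ univ) →
    (∀ t < 0, ∀ x, curl (v t) x = cross (gradient (T t) x) (x - x₀)) →
    (∀ t < 0, ∃ e : E3, e ≠ 0 ∧ ∀ x, inner ℝ e (curl (v t) x) = 0) →
    ∀ t < 0, ∃ (R : E3 ≃ₗᵢ[ℝ] E3) (c : E3), IsAxisymmetricNoSwirlAbout R x₀ (fun y => v t y - c)

/-- Z-1b (dynamic axis freezing on an interval of non-vanishing vorticity; M). -/
def AxisFrozen : Prop :=
  ∀ (v : ℝ → E3 → E3) (x₀ : E3) (T : ℝ → E3 → ℝ),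
    IsBoundedAncientMildSolution 1 v → (∀ t < 0, AEStronglyMeasurable (v t) volume) →
    ContDiffOn ℝ (⊤ : ℕ∞) (uncurry v) (Iio 0 ×ˢ univ) →
    (∀ t < 0, ∀ x, curl (v t) x = cross (gradient (T t) x) (x - x₀)) →
    (∀ t < 0, ∃ (R : E3 ≃ₗᵢ[ℝ] E3) (c : E3), IsAxisymmetricNoSwirlAbout R x₀ (fun y => v t y - c)) →
    ∀ t₁ < 0, (∀ t ≤ t₁, ∃ x, curl (v t) x ≠ 0) →
    ∃ R : E3 ≃ₗᵢ[ℝ] E3, ∀ t ≤ t₁, IsAxisymmetricNoSwirlAbout R x₀ (v t)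

/-- Z-2 (forward vanishing of the vorticity; S/M−). -/
def ForwardVanishing : Prop :=
  ∀ (v : ℝ → E3 → E3),
    IsBoundedAncientMildSolution 1 v → (∀ t < 0, AEStronglyMeasurable (v t) volume) →
    ContDiffOn ℝ (⊤ : ℕ∞) (uncurry v) (Iio 0 ×ˢ univ) →
    ∀ a < 0, (∀ x, curl (v a) x = 0) → ∀ t, a ≤ t → t < 0 → ∀ x, curl (v t) x = 0

/-- Z-3 (KNSS Thm 5.2 transferred to a fixed frame on `(-∞, t₁]`; M−). -/
def KNSSTransfer : Prop :=
  ∀ (v : ℝ → E3 → E3) (x₀ : E3),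
    IsBoundedAncientMildSolution 1 v → (∀ t < 0, AEStronglyMeasurable (v t) volume) →
    ContDiffOn ℝ (⊤ : ℕ∞) (uncurry v) (Iio 0 ×ˢ univ) →
    ∀ t₁ < 0, ∀ R : E3 ≃ₗᵢ[ℝ] E3, (∀ t ≤ t₁, IsAxisymmetricNoSwirlAbout R x₀ (v t)) →
    ∀ t ≤ t₁, ∀ x, curl (v t) x = 0

/-! ### §2 Registered stubs (v1.3: all four closed BY NAME; 0 `sorry`) -/

/-- STUB Z-1a — CLOSED BY NAME (p696980 `CellFlux.zonalKinematic`). [cocycle averaging over the rotations about `x₀ + ℝe`; bounded harmonic fields are constant; `ρ u_φ` constant and `0` at the axis] -/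
theorem stub_zonalKinematic : ZonalKinematic :=
  Summit.NavierStokesRegularity.NavierStokesRegularity.Theorems.PoloidalLiouville.CellFlux.zonalKinematic

/-- STUB Z-1b — CLOSED BY NAME (`CellFlux.axisFrozen`, ns-qj-p1 g6; helper files `…CellFluxAxisFrozenStatics` p697816, `…Frame` p698714, `…Package` p698963). [`Theorems.PoloidalLiouville.vorticityOfClass` (classical vorticity equation) + the frame identity; `e(t) ∥ ω(t,x₁) × ω(t,x₂)` locally] -/
theorem stub_axisFrozen : AxisFrozen :=
  Summit.NavierStokesRegularity.NavierStokesRegularity.Theorems.PoloidalLiouville.CellFlux.axisFrozen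

/-- STUB Z-2 — CLOSED BY NAME (p696036 `CellFlux.forwardVanishing`). [`Theorems.oseen_gauge_of_aestronglyMeasurable` + `oseenMild_bounded_unique`: a constant datum stays constant] -/
theorem stub_forwardVanishing : ForwardVanishing :=
  Summit.NavierStokesRegularity.NavierStokesRegularity.Theorems.PoloidalLiouville.CellFlux.forwardVanishing

/-- STUB Z-3 — CLOSED BY NAME (p696933 `CellFlux.knssTransfer`). [`IsAncientMildSolution.time_translate`, translation covariance, `IsBoundedAncientMildSolution.conj_linearIsometryEquiv`,
`knss_axisymmetric_no_swirl_holds`; a.e.-constant continuous slices are constant; continuity of `curl v` in `t` at `t₁`] -/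
theorem stub_knssTransfer : KNSSTransfer :=
  Summit.NavierStokesRegularity.NavierStokesRegularity.Theorems.PoloidalLiouville.CellFlux.knssTransfer

/-! ### §3 Kernel-checked composition -/

/-- **Z from the four stubs** (pure logic): if `ω(t₁) ≢ 0`, forward vanishing (Z-2, contrapositive) gives `ω(t) ≢ 0` for every `t ≤ t₁`; the
kinematic representation (Z-1a) and axis freezing (Z-1b) give ONE frame on `(-∞, t₁]`; the KNSS transfer (Z-3) gives `ω(t₁) ≡ 0` — contradiction. -/
theorem zonalVorticityVanishes_of (h1a : ZonalKinematic) (h1b : AxisFrozen) (h2 : ForwardVanishing) (h3 : KNSSTransfer) :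
    ZonalUnthreadedVorticityVanishes := by
  intro v x₀ T hB hm hsv hlink hzon t₁ ht₁ x
  by_contra hx
  have hnv : ∀ t ≤ t₁, ∃ y, curl (v t) y ≠ 0 := by
    intro t ht
    by_contra hall
    simp only [ne_eq, not_exists, not_not] at hall
    exact hx (h2 v hB hm hsv t (lt_of_le_of_lt ht ht₁) hall t₁ ht ht₁ x)
  obtain ⟨R, hR⟩ := h1b v x₀ T hB hm hsv hlink (h1a v x₀ T hB hm hsv hlink hzon) t₁ ht₁ hnv
  exact hx (h3 v x₀ hB hm hsv t₁ ht₁ R hR t₁ le_rfl x)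

/-- The composition run on the registered stubs (sorries = exactly the four stubs). -/
theorem zonalVorticityVanishes_of_stubs : ZonalUnthreadedVorticityVanishes :=
  zonalVorticityVanishes_of stub_zonalKinematic stub_axisFrozen stub_forwardVanishing stub_knssTransfer

/-! ### §4 The landed Theorems-side target, by name (p692073 `Theorems/UnthreadedDoorCellFluxDefs.lean`) -/

/-- Anti-drift guard: the local copy IS the landed decl. -/
example : ZonalUnthreadedVorticityVanishes =
    Summit.NavierStokesRegularity.NavierStokesRegularity.Theorems.PoloidalLiouville.CellFlux.ZonalUnthreadedVorticityVanishes := rfl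

/-- **Z, Theorems-side decl, from the four stubs** (what a prover lands as `theorem … : CellFlux.ZonalUnthreadedVorticityVanishes` once the stubs close). -/
theorem theorems_zonalVorticityVanishes_of (h1a : ZonalKinematic) (h1b : AxisFrozen) (h2 : ForwardVanishing) (h3 : KNSSTransfer) :
    Summit.NavierStokesRegularity.NavierStokesRegularity.Theorems.PoloidalLiouville.CellFlux.ZonalUnthreadedVorticityVanishes :=
  zonalVorticityVanishes_of h1a h1b h2 h3

theorem theorems_zonalVorticityVanishes_of_stubs :
    Summit.NavierStokesRegularity.NavierStokesRegularity.Theorems.PoloidalLiouville.CellFlux.ZonalUnthreadedVorticityVanishes :=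
  zonalVorticityVanishes_of_stubs

/-- Anti-drift guards (v1.2): the frame vocabulary and the four stub statements ARE the landed ZDefs decls (p696007). -/
example : @conjAxis = @Summit.NavierStokesRegularity.NavierStokesRegularity.Theorems.PoloidalLiouville.CellFlux.conjAxis := rfl
example : @IsAxisymmetricNoSwirlAbout =
    @Summit.NavierStokesRegularity.NavierStokesRegularity.Theorems.PoloidalLiouville.CellFlux.IsAxisymmetricNoSwirlAbout := rfl
example : ZonalKinematic = Summit.NavierStokesRegularity.NavierStokesRegularity.Theorems.PoloidalLiouville.CellFlux.ZonalKinematic := rfl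
example : AxisFrozen = Summit.NavierStokesRegularity.NavierStokesRegularity.Theorems.PoloidalLiouville.CellFlux.AxisFrozen := rfl
example : ForwardVanishing = Summit.NavierStokesRegularity.NavierStokesRegularity.Theorems.PoloidalLiouville.CellFlux.ForwardVanishing := rfl
example : KNSSTransfer = Summit.NavierStokesRegularity.NavierStokesRegularity.Theorems.PoloidalLiouville.CellFlux.KNSSTransfer := rfl

/-- **§5 (v1.3: nothing remains)**: Z, Theorems side, via the LANDED composition `CellFlux.zonalUnthreadedVorticityVanishes_of`
(ZDefs p696007) fed with the four landed stubs by name; kept in the `_of_axisFrozen` shape of v1.2 and then discharged below. -/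
theorem theorems_zonalVorticityVanishes_of_axisFrozen
    (h1b : Summit.NavierStokesRegularity.NavierStokesRegularity.Theorems.PoloidalLiouville.CellFlux.AxisFrozen) :
    Summit.NavierStokesRegularity.NavierStokesRegularity.Theorems.PoloidalLiouville.CellFlux.ZonalUnthreadedVorticityVanishes :=
  Summit.NavierStokesRegularity.NavierStokesRegularity.Theorems.PoloidalLiouville.CellFlux.zonalUnthreadedVorticityVanishes_of
    Summit.NavierStokesRegularity.NavierStokesRegularity.Theorems.PoloidalLiouville.CellFlux.zonalKinematic h1b
    Summit.NavierStokesRegularity.NavierStokesRegularity.Theorems.PoloidalLiouville.CellFlux.forwardVanishing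
    Summit.NavierStokesRegularity.NavierStokesRegularity.Theorems.PoloidalLiouville.CellFlux.knssTransfer

/-- … and the zonal Type-I rung Σ-Z from the one open stub (landed `zonalTypeIScalarLiouville_of`, ZDefs). -/
theorem theorems_zonalTypeIScalarLiouville_of_axisFrozen
    (h1b : Summit.NavierStokesRegularity.NavierStokesRegularity.Theorems.PoloidalLiouville.CellFlux.AxisFrozen) :
    Summit.NavierStokesRegularity.NavierStokesRegularity.Theorems.PoloidalLiouville.CellFlux.ZonalTypeIScalarLiouville :=
  Summit.NavierStokesRegularity.NavierStokesRegularity.Theorems.PoloidalLiouville.CellFlux.zonalTypeIScalarLiouville_of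
    Summit.NavierStokesRegularity.NavierStokesRegularity.Theorems.PoloidalLiouville.CellFlux.zonalKinematic h1b
    Summit.NavierStokesRegularity.NavierStokesRegularity.Theorems.PoloidalLiouville.CellFlux.forwardVanishing
    Summit.NavierStokesRegularity.NavierStokesRegularity.Theorems.PoloidalLiouville.CellFlux.knssTransfer

/-- **Z UNCONDITIONALLY (v1.3)**: `ZonalUnthreadedVorticityVanishes` — every ZONAL member of the unthreaded bounded-ancient class has `curl v ≡ 0`
(KNSS Thm 5.2 in a moving frame).  This is the zonal branch only; 1222 `PoloidalLiouville` stays OPEN; NS regularity is NOT proved. -/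
theorem theorems_zonalVorticityVanishes :
    Summit.NavierStokesRegularity.NavierStokesRegularity.Theorems.PoloidalLiouville.CellFlux.ZonalUnthreadedVorticityVanishes :=
  theorems_zonalVorticityVanishes_of_axisFrozen
    Summit.NavierStokesRegularity.NavierStokesRegularity.Theorems.PoloidalLiouville.CellFlux.axisFrozen

/-- **Σ-Z UNCONDITIONALLY (v1.3)**: the zonal Type-I rung `ZonalTypeIScalarLiouville` is a theorem. -/
theorem theorems_zonalTypeIScalarLiouville :
    Summit.NavierStokesRegularity.NavierStokesRegularity.Theorems.PoloidalLiouville.CellFlux.ZonalTypeIScalarLiouville :=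
  theorems_zonalTypeIScalarLiouville_of_axisFrozen
    Summit.NavierStokesRegularity.NavierStokesRegularity.Theorems.PoloidalLiouville.CellFlux.axisFrozen

end Summit.NavierStokesRegularity.NavierStokesRegularity.Cruxes.PoloidalLiouville.CellFlux.ZSkeleton

end
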